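import Summits.Ventures.HSemireg.WedgeHankelSubstitutionClassSpace

/-!
# Venture HSemireg — A SINGULAR SUBSTITUTION ON THE CLASSES IS `(tr g)^n` TIMES AN IDEMPOTENT, OR SQUARE-ZERO: `S_c(g)² = (α+δ)^c · S_c(g)` whenever `αδ = βγ`
# (every field, every degree `c`, no case split), hence `SbC(g)² = (α+δ)^n · SbC(g)` on th-7's class space; `SbC(g)² = 0` for a NILPOTENT letter map
# (`α + δ = 0`, `n ≥ 1`), and `((α+δ)^n)⁻¹ · SbC(g)` is an idempotent when `α + δ ≠ 0`

HONEST FRAMING. Part of the Lean index of the computation cell `pub-hsemireg` (seat p10 gen 19, Sunday typer «UNIFORM-IN-n»).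
Finite-dimensional EXTERIOR ALGEBRA + linear algebra ONLY: no variety, no cohomology theory, no sheaf, no Ext group, no semiregularity map;
nothing here says that HC / HC_CM / HC_AV holds; no Literature fact is declared or used.  Custodian versions as in `WedgeHankelSiegelIdeal` (1/3) and `WedgeHankelFrameChange`.

WHAT IS IN THE TREE.  I1 `sbMat_comp` (`S_c(g·g′) = S_c(g′)·S_c(g)`), `sbMat_one`, `sbMat_scalar` (`S_c(t,0,0,t) = t^c·1`); I9 `sbMat_diag` (`S_c(a,0,0,d)` diagonal); I11 `SbC`, `toMatrix_SbC` (`= S_n(g)` in the spike basis);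
I12 (`WedgeHankelClassSpaceMonoid`): for `α ≠ 0`, `αδ = βγ` the restriction `SbC(g)` has RANK ONE with image the pure line of `x + (β/α)y`; H5 the cases `α = 0`.
THIS FILE (namespace `…Wedge.HankelFrameChange` continued; imports I11) adds the one identity those files do not state, by Cayley–Hamilton for `2 × 2` matrices
(`det g = 0 ⇒ g² = (tr g)·g`) and the anti-multiplicativity + homogeneity of `S_c`:
* §216 `sbMat_scalar_mul` (`S_c(t·g) = t^c · S_c(g)`), **`sbMat_mul_self_of_det_eq_zero`: `S_c(g)·S_c(g) = (α+δ)^c · S_c(g)` for `αδ = βγ`**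
  (every field, every `c`; `α = 0` included).
* §217 on the class space: **`SbC_mul_self_of_det_eq_zero`** (`SbC(g)·SbC(g) = (α+δ)^n · SbC(g)`), **`SbC_mul_self_eq_zero_of_nilpotent`** (`αδ = βγ`, `α + δ = 0`, `1 ≤ n` ⇒
  `SbC(g)² = 0`: a nilpotent letter map is SQUARE-ZERO on the classes), **`SbC_idempotent_of_det_eq_zero`** (`α + δ ≠ 0` ⇒ `P := ((α+δ)^n)⁻¹ · SbC(g)` has `P·P = P`;
  with I12, a rank-one idempotent — the projection onto the pure line of the image letter along the hyperplane `c(q) = 0`).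
NOT typed here: the trace `tr SbC(g) = (α+δ)^n` for singular `g`; anything Ext-side.  New names only.
-/

open Module

namespace Summit.Ventures.HSemireg.Wedge.HankelFrameChange

open Summit.Ventures.HSemireg.Wedge Summit.Ventures.HSemireg.Wedge.Kunneth Summit.Ventures.HSemireg.Wedge.Hankel
  Summit.Ventures.HSemireg.Wedge.BasisFree Summit.Ventures.HSemireg.Wedge.HankelSiegel Summit.Ventures.HSemireg.Wedge.HankelSiegelIdeal
  Summit.Ventures.HSemireg.Wedge.KunnethKernel Summit.Ventures.HSemireg.Wedge.HankelRankOne Summit.Ventures.HSemireg.Wedge.KernelDuality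

variable (K : Type*) [Field K] {n : ℕ}

/-! ## §216. `S_c(g)² = (tr g)^c · S_c(g)` for a singular `g` -/

/-- **HOMOGENEITY: `S_c(t·g) = t^c · S_c(g)`** (`t·g = (t·1)·g` and I1's composition law). -/
theorem sbMat_scalar_mul (t α β γ δ : K) (c : ℕ) : sbMat K (t * α) (t * β) (t * γ) (t * δ) c (c + 1) = t ^ c • sbMat K α β γ δ c (c + 1) := by
  have h := sbMat_comp K t 0 0 t α β γ δ c
  rw [zero_mul, add_zero, zero_mul, add_zero, zero_mul, zero_add, zero_mul, zero_add, sbMat_scalar, Matrix.mul_smul, Matrix.mul_one] at h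
  exact h

/-- **`S_c(g)·S_c(g) = (α+δ)^c · S_c(g)` WHENEVER `αδ = βγ`** (every field, every degree `c`, no hypothesis on `α`): Cayley–Hamilton `g² = (tr g)·g` for the singular
`2 × 2` matrix `g`, transported by `S_c(g·g′) = S_c(g′)·S_c(g)` and homogeneity. -/
theorem sbMat_mul_self_of_det_eq_zero {α β γ δ : K} (hdet : α * δ - β * γ = 0) (c : ℕ) :
    sbMat K α β γ δ c (c + 1) * sbMat K α β γ δ c (c + 1) = (α + δ) ^ c • sbMat K α β γ δ c (c + 1) := by
  have hβγ : β * γ = α * δ := (sub_eq_zero.mp hdet).symm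
  have h := sbMat_comp K α β γ δ α β γ δ c
  -- `g·g = ((α+δ)·1)·g` entrywise, using `βγ = αδ`
  have e1 : α * α + β * γ = (α + δ) * α := by rw [hβγ]; ring
  have e2 : α * β + β * δ = (α + δ) * β := by ring
  have e3 : γ * α + δ * γ = (α + δ) * γ := by ring
  have e4 : γ * β + δ * δ = (α + δ) * δ := by rw [mul_comm γ β, hβγ]; ring
  rw [e1, e2, e3, e4, sbMat_scalar_mul] at h
  exact h.symm

/-- in particular **`S_c(g)·S_c(g) = 0` for a NILPOTENT letter map** (`αδ = βγ`, `α + δ = 0`) in every degree `c ≥ 1`. -/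
theorem sbMat_mul_self_eq_zero_of_nilpotent {α β γ δ : K} (hdet : α * δ - β * γ = 0) (htr : α + δ = 0) {c : ℕ} (hc : 1 ≤ c) :
    sbMat K α β γ δ c (c + 1) * sbMat K α β γ δ c (c + 1) = 0 := by
  rw [sbMat_mul_self_of_det_eq_zero K hdet, htr, zero_pow (by omega), zero_smul]

/-! ## §217. On th-7's class space: idempotent up to `(tr g)^n`, or square-zero -/

/-- **`SbC(g)·SbC(g) = (α+δ)^n · SbC(g)` whenever `αδ = βγ`** (I11 `toMatrix_SbC` + §216). -/
theorem SbC_mul_self_of_det_eq_zero {α β γ δ : K} (hdet : α * δ - β * γ = 0) :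
    SbC K α β γ δ (n := n) * SbC K α β γ δ = (α + δ) ^ n • SbC K α β γ δ := by
  apply (LinearMap.toMatrix (spikeBasis K n) (spikeBasis K n)).injective
  rw [LinearMap.toMatrix_mul, toMatrix_SbC, sbMat_mul_self_of_det_eq_zero K hdet, map_smul, toMatrix_SbC]

/-- **a NILPOTENT letter map is SQUARE-ZERO on the classes: `SbC(g)·SbC(g) = 0`** for `αδ = βγ`, `α + δ = 0`, `n ≥ 1` (with I12: image = the pure line of its image
letter, which lies in its kernel hyperplane). -/
theorem SbC_mul_self_eq_zero_of_nilpotent {α β γ δ : K} (hdet : α * δ - β * γ = 0) (htr : α + δ = 0) (hn : 1 ≤ n) :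
    SbC K α β γ δ (n := n) * SbC K α β γ δ = 0 := by
  rw [SbC_mul_self_of_det_eq_zero K hdet, htr, zero_pow (by omega), zero_smul]

/-- **for a singular, non-nilpotent letter map, `P := ((α+δ)^n)⁻¹ · SbC(g)` is an IDEMPOTENT** (`P·P = P`; with I12 `finrank_range_SbC_of_det_eq_zero`: of rank one — the
projection of the class space onto the pure line of the image letter). -/
theorem SbC_idempotent_of_det_eq_zero {α β γ δ : K} (hdet : α * δ - β * γ = 0) (htr : α + δ ≠ 0) :
    (((α + δ) ^ n)⁻¹ • SbC K α β γ δ (n := n)) * (((α + δ) ^ n)⁻¹ • SbC K α β γ δ) = ((α + δ) ^ n)⁻¹ • SbC K α β γ δ := by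
  have hu : (α + δ) ^ n ≠ 0 := pow_ne_zero _ htr
  rw [smul_mul_smul_comm, SbC_mul_self_of_det_eq_zero K hdet, smul_smul, mul_assoc, inv_mul_cancel₀ hu, mul_one]

/-- the same as the fixed-point equation `SbC(g) (SbC(g) f) = (α+δ)^n · SbC(g) f` on every class `f`. -/
theorem SbC_SbC_apply_of_det_eq_zero {α β γ δ : K} (hdet : α * δ - β * γ = 0) (f : spikeSpan K n) :
    SbC K α β γ δ (SbC K α β γ δ f) = (α + δ) ^ n • SbC K α β γ δ f := by
  have h := congrArg (fun T : spikeSpan K n →ₗ[K] spikeSpan K n => T f) (SbC_mul_self_of_det_eq_zero K (n := n) hdet)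
  simpa only [Module.End.mul_apply, LinearMap.smul_apply] using h

end Summit.Ventures.HSemireg.Wedge.HankelFrameChange
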